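import Literature.AlgebraicGeometry.Motives.AbelianVarietyPoincareEquivariantRingOfIntegers
import Literature.AlgebraicGeometry.Motives.AbelianVarietyQuasiSectionPerfectField
import HarnessLib

/-!
# Equivariant quasi-sections of equivariant surjections

Dual of `Motives/AbelianVarietyPoincareEquivariant(Polynomial)` (equivariant quasi-RETRACTIONS
`h̃` of an equivariant closed immersion `i`, `i ≫ h̃ = M • 𝟙`).  Here: an EQUIVARIANT homomorphism
`f : S ⟶ B` of abelian varieties with actions of a finite group or of a commutative ring
generated up to isogeny by one element (an order of a CM field), admitting a quasi-section
`t : B ⟶ S`, `t ≫ f = N • 𝟙 B` (every surjection over a perfect field does,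
`exists_quasiSection_of_perfectField`), admits an EQUIVARIANT quasi-section `t̃`,
`t̃ ≫ f = M • 𝟙 B`, `M ≠ 0`.  The averaging is the mirror image of the retraction case: for a
finite group `t̃ = ∑_g ρ_B(g) ≫ t ≫ ρ_S(g⁻¹)`; for commuting endomorphisms `u ∈ End S`,
`u' ∈ End B` with a common integral polynomial `p`, `c_u p + c_v p' = D`, the operator
`P = ∑_m p_m ∑_{j<m} A^j B^{m-1-j}` on `Hom(B, S)` (`A = (u' ≫ ·)`, `B = (· ≫ u)`) has
`(A - B) P = p(A) - p(B) = 0`, so `P t` is equivariant, and `P t ≫ f = N • p'(u')`, whence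
`t̃ = c_v(u') ≫ P t` has `t̃ ≫ f = (N D) • 𝟙 B` (Pierce, *Associative Algebras*, §10.2: the
separability idempotent projects onto bimodule maps).

* `AbelianVariety.exists_equivariant_quasiSection_of_fintype` — finite groups;
* `AbelianVariety.exists_equivariant_quasiSection_of_aeval_eq_zero` — one pair of intertwined
  endomorphisms with a separable integral polynomial;
* `AbelianVariety.exists_equivariant_quasiSection_of_generator` — commutative ring generated up
  to isogeny by `α` with certificate `c_u p + c_v p' = D ≠ 0`;
* `AbelianVariety.exists_equivariant_quasiSection_of_perfectField_of_generator`,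
  `…_of_perfectField_of_fintype`, `…_of_perfectField_of_ringOfIntegers` — **over a perfect field
  every equivariant SURJECTION has an equivariant quasi-section** (for these actions).

Everything is proved; no definition, no named fact (D-0026).

## References

* R. S. Pierce, *Associative Algebras*, GTM 88 (1982), §10.2 (separability idempotents).
  [Pierce1982]
* D. Mumford, *Abelian Varieties* (1970), §19 Thm. 1 and Remark p. 169 (quasi-inverses).
  [MumfordAV1970]
* H. Lange, R. E. Rodríguez, *Decomposition of Jacobians by Prym Varieties*, LNM 2310 (2022),
  Thm. 2.7.1 (Maschke averaging for abelian varieties with `G`-action). [LangeRodriguez2022]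
-/

noncomputable section

universe u v

open CategoryTheory CategoryTheory.Limits AlgebraicGeometry Polynomial
open scoped Polynomial NumberField

namespace Literature.AlgebraicGeometry.Motives

namespace AbelianVariety

variable {K : Type u} [Field K] {S B : AbelianVariety K}

/-! ### Finite groups: Maschke averaging of a quasi-section -/

/-- **Maschke averaging of a quasi-section.** Let a finite group `G` act on `S` and `B`
(`ρ : G →* End S`, `ρ' : G →* End B`), let `f : S ⟶ B` be equivariant (`ρ g ≫ f = f ≫ ρ' g`) with
a quasi-section `t`, `t ≫ f = N • 𝟙 B`. Then `t̃ = ∑_g ρ' g ≫ t ≫ ρ g⁻¹` is an EQUIVARIANT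
quasi-section: `t̃ ≫ f = (#G · N) • 𝟙 B` and `ρ' g ≫ t̃ = t̃ ≫ ρ g`.
[cite: LangeRodriguez2022, Thm. 2.7.1] [cite: MumfordAV1970, §19 Thm. 1 (p. 173)] -/
theorem exists_equivariant_quasiSection_of_fintype {G : Type v} [Group G] [Fintype G]
    (ρ : G →* End S) (ρ' : G →* End B) {f : S ⟶ B} {t : B ⟶ S} {N : ℕ}
    (hf : ∀ g : G, End.asHom (ρ g) ≫ f = f ≫ End.asHom (ρ' g)) (htf : t ≫ f = N • 𝟙 B) :
    ∃ t' : B ⟶ S, t' ≫ f = (Fintype.card G * N) • 𝟙 B ∧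
      ∀ g : G, End.asHom (ρ' g) ≫ t' = t' ≫ End.asHom (ρ g) := by
  have hinv : ∀ g : G, End.asHom (ρ' g) ≫ End.asHom (ρ' g⁻¹) = 𝟙 B := fun g ↦ by
    change ρ' g⁻¹ * ρ' g = 1
    rw [← map_mul, inv_mul_cancel, map_one]
  refine ⟨∑ g : G, End.asHom (ρ' g) ≫ t ≫ End.asHom (ρ g⁻¹), ?_, fun k ↦ ?_⟩
  · rw [Preadditive.sum_comp]
    have e : ∀ g : G, (End.asHom (ρ' g) ≫ t ≫ End.asHom (ρ g⁻¹)) ≫ f = N • 𝟙 B := fun g ↦ by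
      rw [Category.assoc, Category.assoc, hf g⁻¹, ← Category.assoc t f, htf,
        Preadditive.nsmul_comp, Category.id_comp, Preadditive.comp_nsmul, hinv]
    rw [Finset.sum_congr rfl fun g _ ↦ e g, Finset.sum_const, smul_smul, Finset.card_univ]
  · rw [Preadditive.comp_sum, Preadditive.sum_comp]
    -- reindex the left sum along `g ↦ g k`
    refine Fintype.sum_equiv (Equiv.mulRight k) _ _ fun g ↦ ?_
    have e1 : End.asHom (ρ' k) ≫ End.asHom (ρ' g) = End.asHom (ρ' (g * k)) := by
      change ρ' g * ρ' k = ρ' (g * k)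
      rw [map_mul]
    have e2 : End.asHom (ρ (g * k)⁻¹) ≫ End.asHom (ρ k) = End.asHom (ρ g⁻¹) := by
      change ρ k * ρ (g * k)⁻¹ = ρ g⁻¹
      rw [← map_mul, mul_inv_rev, mul_inv_cancel_left]
    simp only [Equiv.coe_mulRight, Category.assoc]
    rw [← Category.assoc (End.asHom (ρ' k)), e1, e2]

/-! ### Commuting endomorphisms with a common separable polynomial -/

section Operators

variable {Z : AbelianVariety K}

/-- Powers of `L_{u'} : g ↦ u' ≫ g` on `Hom(B, Z)`: `L^n g = u'^n ≫ g` (private plumbing, the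
mirror of `Motives/AbelianVarietyPoincareEquivariantPolynomial`). [folklore] -/
private theorem leftOp_pow_apply (u' : End B) (n : ℕ) (g : B ⟶ Z) :
    (((Preadditive.leftComp Z (End.asHom u')).toIntLinearMap : Module.End ℤ (B ⟶ Z)) ^ n) g =
      End.asHom (u' ^ n) ≫ g := by
  induction n generalizing g with
  | zero => rw [pow_zero, pow_zero, Module.End.one_apply]; exact (Category.id_comp g).symm
  | succ n ih =>
    rw [pow_succ, Module.End.mul_apply, ih]
    change End.asHom (u' ^ n) ≫ (End.asHom u' ≫ g) = End.asHom (u' ^ (n + 1)) ≫ g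
    rw [pow_succ', ← Category.assoc]
    rfl

/-- Powers of `R_u : g ↦ g ≫ u` on `Hom(Z, S)`: `R^n g = g ≫ u^n`. [folklore] -/
private theorem rightOp_pow_apply (u : End S) (n : ℕ) (g : Z ⟶ S) :
    (((Preadditive.rightComp Z (End.asHom u)).toIntLinearMap : Module.End ℤ (Z ⟶ S)) ^ n) g =
      g ≫ End.asHom (u ^ n) := by
  induction n generalizing g with
  | zero => rw [pow_zero, pow_zero, Module.End.one_apply]; exact (Category.comp_id g).symm
  | succ n ih =>
    rw [pow_succ, Module.End.mul_apply, ih]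
    change (g ≫ End.asHom u) ≫ End.asHom (u ^ n) = g ≫ End.asHom (u ^ (n + 1))
    rw [pow_succ, Category.assoc]
    rfl

/-- Polynomials in `L_{u'}` act as `q(u') ≫ ·`. [folklore] -/
private theorem aeval_leftOp_apply (u' : End B) (q : ℤ[X]) (g : B ⟶ Z) :
    (aeval ((Preadditive.leftComp Z (End.asHom u')).toIntLinearMap : Module.End ℤ (B ⟶ Z)) q) g =
      End.asHom (aeval u' q) ≫ g := by
  induction q using Polynomial.induction_on' with
  | add p q hp hq =>
    rw [map_add, map_add, LinearMap.add_apply, hp, hq]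
    change _ = (End.asHom (aeval u' p) + End.asHom (aeval u' q)) ≫ g
    rw [Preadditive.add_comp]
  | monomial n c =>
    rw [aeval_monomial, aeval_monomial, Module.End.mul_apply, leftOp_pow_apply,
      Module.algebraMap_end_apply, Algebra.algebraMap_eq_smul_one, smul_mul_assoc, one_mul]
    change _ = (c • End.asHom (u' ^ n)) ≫ g
    rw [Preadditive.zsmul_comp]

/-- Polynomials in `R_u` act as `· ≫ q(u)`. [folklore] -/
private theorem aeval_rightOp_apply (u : End S) (q : ℤ[X]) (g : Z ⟶ S) :
    (aeval ((Preadditive.rightComp Z (End.asHom u)).toIntLinearMap : Module.End ℤ (Z ⟶ S)) q) g =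
      g ≫ End.asHom (aeval u q) := by
  induction q using Polynomial.induction_on' with
  | add p q hp hq =>
    rw [map_add, map_add, LinearMap.add_apply, hp, hq]
    change _ = g ≫ (End.asHom (aeval u p) + End.asHom (aeval u q))
    rw [Preadditive.comp_add]
  | monomial n c =>
    rw [aeval_monomial, aeval_monomial, Module.End.mul_apply, rightOp_pow_apply,
      Module.algebraMap_end_apply, Algebra.algebraMap_eq_smul_one, smul_mul_assoc, one_mul]
    change _ = g ≫ (c • End.asHom (u ^ n))
    rw [Preadditive.comp_zsmul]

/-- `q(u')` as a `Hom`-valued sum `∑_{k<n} q_k • u'^k` for `natDegree q < n`. [folklore] -/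
private theorem asHom_aeval_eq_sum' (u' : End B) (q : ℤ[X]) {n : ℕ} (hn : q.natDegree < n) :
    End.asHom (aeval u' q) = ∑ k ∈ Finset.range n, q.coeff k • End.asHom (u' ^ k) := by
  have e := aeval_leftOp_apply (Z := B) u' q (𝟙 B)
  rw [Category.comp_id, aeval_eq_sum_range' hn, LinearMap.sum_apply] at e
  rw [← e]
  refine Finset.sum_congr rfl fun k _ ↦ ?_
  rw [LinearMap.smul_apply, leftOp_pow_apply, Category.comp_id]

end Operators

/-- An intertwining `u ≫ f = f ≫ u'` extends to all powers. [folklore] -/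
private theorem asHom_pow_comp_of_comp_eq {f : S ⟶ B} {u : End S} {u' : End B}
    (hf : End.asHom u ≫ f = f ≫ End.asHom u') (n : ℕ) :
    End.asHom (u ^ n) ≫ f = f ≫ End.asHom (u' ^ n) := by
  induction n with
  | zero => simp only [pow_zero]; exact (Category.id_comp f).trans (Category.comp_id f).symm
  | succ n ih =>
    rw [pow_succ', pow_succ']
    change (End.asHom (u ^ n) ≫ End.asHom u) ≫ f = f ≫ (End.asHom (u' ^ n) ≫ End.asHom u')
    rw [Category.assoc, hf, ← Category.assoc, ih, Category.assoc]

/-- **Equivariant quasi-section for endomorphisms with a common separable integral polynomial.**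
Let `u ∈ End S`, `u' ∈ End B` be intertwined by `f : S ⟶ B` (`u ≫ f = f ≫ u'`), let
`p, c_u, c_v ∈ ℤ[T]`, `D ∈ ℤ` with `p(u) = 0`, `p(u') = 0`, `c_u p + c_v p' = D`, and let `t` be a
quasi-section of `f`, `t ≫ f = N • 𝟙 B`. Then there is `t̃ : B ⟶ S` with `t̃ ≫ f = (N D) • 𝟙 B`
and `u' ≫ t̃ = t̃ ≫ u` — namely `t̃ = c_v(u') ≫ P t` for the separability operator
`P = ∑_m p_m ∑_{j<m} A^j B^{m-1-j}`, `A = (u' ≫ ·)`, `B = (· ≫ u)` on `Hom(B, S)`.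
[cite: Pierce1982, §10.2] [cite: MumfordAV1970, §19 Thm. 1 and Remark p. 169] -/
theorem exists_equivariant_quasiSection_of_aeval_eq_zero (u : End S) (u' : End B)
    {f : S ⟶ B} {t : B ⟶ S} {N : ℕ} (hf : End.asHom u ≫ f = f ≫ End.asHom u')
    (htf : t ≫ f = N • 𝟙 B) (p cu cv : ℤ[X]) (D : ℤ) (hp : aeval u p = 0) (hp' : aeval u' p = 0)
    (hD : cu * p + cv * derivative p = C D) :
    ∃ t' : B ⟶ S, t' ≫ f = ((N : ℤ) * D) • 𝟙 B ∧ End.asHom u' ≫ t' = t' ≫ End.asHom u := by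
  classical
  -- the commuting operators `A = (u' ≫ ·)`, `Bo = (· ≫ u)` on `V = Hom(B, S)`
  let A : Module.End ℤ (B ⟶ S) := (Preadditive.leftComp S (End.asHom u')).toIntLinearMap
  let Bo : Module.End ℤ (B ⟶ S) := (Preadditive.rightComp B (End.asHom u)).toIntLinearMap
  have hA : ∀ g, A g = End.asHom u' ≫ g := fun g ↦ rfl
  have hB : ∀ g, Bo g = g ≫ End.asHom u := fun g ↦ rfl
  have hApow : ∀ (n : ℕ) (g : B ⟶ S), (A ^ n) g = End.asHom (u' ^ n) ≫ g :=
    fun n g ↦ leftOp_pow_apply u' n g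
  have hBpow : ∀ (n : ℕ) (g : B ⟶ S), (Bo ^ n) g = g ≫ End.asHom (u ^ n) :=
    fun n g ↦ rightOp_pow_apply u n g
  have hAB : Commute A Bo := by
    change A * Bo = Bo * A
    refine LinearMap.ext fun g ↦ ?_
    rw [Module.End.mul_apply, Module.End.mul_apply, hA, hB, hA, hB, Category.assoc]
  have hpA : aeval A p = 0 := by
    refine LinearMap.ext fun g ↦ ?_
    rw [aeval_leftOp_apply, hp', LinearMap.zero_apply]
    exact Limits.zero_comp
  have hpB : aeval Bo p = 0 := by
    refine LinearMap.ext fun g ↦ ?_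
    rw [aeval_rightOp_apply, hp, LinearMap.zero_apply]
    exact Limits.comp_zero
  -- the operator `P` with `(A - Bo) P = p(A) - p(Bo) = 0`
  let E : ℕ → Module.End ℤ (B ⟶ S) := fun m ↦ ∑ j ∈ Finset.range m, A ^ j * Bo ^ (m - 1 - j)
  let P : Module.End ℤ (B ⟶ S) := ∑ m ∈ Finset.range (p.natDegree + 1), p.coeff m • E m
  have hPE : ∀ m, E m * (A - Bo) = A ^ m - Bo ^ m := fun m ↦ hAB.geom_sum₂_mul m
  have hcommE : ∀ m, Commute (A - Bo) (E m) := fun m ↦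
    Commute.sum_right _ _ _ fun j _ ↦
      ((Commute.refl A).sub_left hAB.symm).pow_right j |>.mul_right
        ((hAB.sub_left (Commute.refl Bo)).pow_right (m - 1 - j))
  have hP : (A - Bo) * P = 0 := by
    have hcomm : Commute (A - Bo) P :=
      Commute.sum_right _ _ _ fun m _ ↦ (hcommE m).smul_right (p.coeff m)
    rw [hcomm.eq]
    change (∑ m ∈ Finset.range (p.natDegree + 1), p.coeff m • E m) * (A - Bo) = 0
    rw [Finset.sum_mul]
    simp_rw [smul_mul_assoc, hPE, smul_sub, Finset.sum_sub_distrib]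
    rw [← aeval_eq_sum_range, ← aeval_eq_sum_range, hpA, hpB, sub_zero]
  -- `P t` is equivariant
  have hequiv : End.asHom u' ≫ P t = P t ≫ End.asHom u := by
    have e := congrArg (fun T : Module.End ℤ (B ⟶ S) ↦ T t) hP
    simp only [Module.End.mul_apply, LinearMap.sub_apply, LinearMap.zero_apply, hA, hB] at e
    exact sub_eq_zero.1 e
  -- `P t ≫ f = N • p'(u')`
  have hEf : ∀ m, (E m) t ≫ f = (N * m : ℤ) • End.asHom (u' ^ (m - 1)) := by
    intro m
    change (∑ j ∈ Finset.range m, A ^ j * Bo ^ (m - 1 - j)) t ≫ f = _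
    rw [LinearMap.sum_apply, Preadditive.sum_comp]
    have e : ∀ j ∈ Finset.range m, (A ^ j * Bo ^ (m - 1 - j)) t ≫ f =
        (N : ℤ) • End.asHom (u' ^ (m - 1)) := by
      intro j hj
      rw [Module.End.mul_apply, hBpow, hApow, Category.assoc, Category.assoc,
        asHom_pow_comp_of_comp_eq hf, ← Category.assoc t f, htf, Preadditive.nsmul_comp,
        Category.id_comp, Preadditive.comp_nsmul, ← natCast_zsmul]
      congr 1
      change u' ^ (m - 1 - j) * u' ^ j = u' ^ (m - 1)
      rw [← pow_add, show m - 1 - j + j = m - 1 by have := Finset.mem_range.1 hj; omega]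
    rw [Finset.sum_congr rfl e, Finset.sum_const, Finset.card_range, ← natCast_zsmul, smul_smul,
      mul_comm (m : ℤ)]
  have hdeg : (derivative p).natDegree < p.natDegree + 1 :=
    (natDegree_derivative_le p).trans_lt (by omega)
  have hPf : P t ≫ f = (N : ℤ) • End.asHom (aeval u' (derivative p)) := by
    change (∑ m ∈ Finset.range (p.natDegree + 1), p.coeff m • E m) t ≫ f = _
    rw [LinearMap.sum_apply, Preadditive.sum_comp]
    simp_rw [LinearMap.smul_apply, Preadditive.zsmul_comp, hEf, smul_smul]
    rw [Finset.sum_range_succ', Nat.cast_zero, mul_zero, mul_zero, zero_smul, add_zero,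
      asHom_aeval_eq_sum' u' (derivative p) hdeg, Finset.smul_sum, Finset.sum_range_succ,
      coeff_derivative, coeff_eq_zero_of_natDegree_lt (Nat.lt_succ_self _), zero_mul, zero_smul,
      smul_zero, add_zero]
    refine Finset.sum_congr rfl fun k _ ↦ ?_
    rw [coeff_derivative, smul_smul, Nat.add_sub_cancel]
    push_cast
    congr 1
    ring
  -- the equivariant quasi-section `t̃ = c_v(u') ≫ P t`
  refine ⟨End.asHom (aeval u' cv) ≫ P t, ?_, ?_⟩
  · rw [Category.assoc, hPf, Preadditive.comp_zsmul]
    change (N : ℤ) • End.asHom (aeval u' (derivative p) * aeval u' cv) = _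
    rw [← map_mul, show derivative p * cv = C D - cu * p by rw [← hD]; ring, map_sub, map_mul, hp',
      mul_zero, sub_zero, aeval_C, Algebra.algebraMap_eq_smul_one]
    change (N : ℤ) • (D • 𝟙 B) = _
    rw [smul_smul]
  · have ec : End.asHom u' ≫ End.asHom (aeval u' cv) = End.asHom (aeval u' cv) ≫ End.asHom u' := by
      change aeval u' cv * u' = u' * aeval u' cv
      have h1 : aeval u' (cv * Polynomial.X) = aeval u' (Polynomial.X * cv) := by rw [mul_comm]
      simpa only [map_mul, aeval_X] using h1
    rw [← Category.assoc, ec, Category.assoc, hequiv, Category.assoc]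

/-- **Equivariant quasi-section for a commutative ring generated up to isogeny by one element.**
Let `φ : R →+* End S`, `ψ : R →+* End B` be actions of a commutative ring generated up to
isogeny by `α` (`m r = q(α)`, `m ≠ 0`) with `p(α) = 0`, `c_u p + c_v p' = D ≠ 0`, let `f : S ⟶ B`
be equivariant with a quasi-section `t ≫ f = N • 𝟙 B`, `N ≠ 0`. Then `f` has an EQUIVARIANT
quasi-section `t̃ ≫ f = M • 𝟙 B`, `M ≠ 0`, `ψ r ≫ t̃ = t̃ ≫ φ r`.
[cite: Pierce1982, §10.2] [cite: MumfordAV1970, §19 Thm. 1 and Remark p. 169] -/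
theorem exists_equivariant_quasiSection_of_generator {R : Type v} [CommRing R]
    (φ : R →+* End S) (ψ : R →+* End B) {f : S ⟶ B} {t : B ⟶ S} {N : ℕ}
    (hf : ∀ r : R, End.asHom (φ r) ≫ f = f ≫ End.asHom (ψ r)) (hN : N ≠ 0)
    (htf : t ≫ f = N • 𝟙 B) (α : R) (p cu cv : Polynomial ℤ) (D : ℤ) (hD : D ≠ 0)
    (hp : aeval α p = 0) (hcert : cu * p + cv * derivative p = C D)
    (hgen : ∀ r : R, ∃ (m : ℕ) (q : Polynomial ℤ), m ≠ 0 ∧ (m : R) * r = aeval α q) :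
    ∃ (t' : B ⟶ S) (M : ℕ), M ≠ 0 ∧ t' ≫ f = M • 𝟙 B ∧
      ∀ r : R, End.asHom (ψ r) ≫ t' = t' ≫ End.asHom (φ r) := by
  have hpφ : aeval (φ α) p = 0 := by
    have e : φ (aeval α p) = aeval (φ α) p := by
      rw [aeval_def, aeval_def, Polynomial.hom_eval₂, RingHom.ext_int (φ.comp _) (algebraMap ℤ _)]
    rw [← e, hp, map_zero]
  have hpψ : aeval (ψ α) p = 0 := by
    have e : ψ (aeval α p) = aeval (ψ α) p := by
      rw [aeval_def, aeval_def, Polynomial.hom_eval₂, RingHom.ext_int (ψ.comp _) (algebraMap ℤ _)]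
    rw [← e, hp, map_zero]
  obtain ⟨t₁, ht₁, he₁⟩ := exists_equivariant_quasiSection_of_aeval_eq_zero (φ α) (ψ α) (hf α)
    htf p cu cv D hpφ hpψ hcert
  -- normalise the sign
  have ht : (D.sign • t₁) ≫ f = (N * D.natAbs) • 𝟙 B := by
    rw [Preadditive.zsmul_comp, ht₁, smul_smul, ← natCast_zsmul, Nat.cast_mul,
      ← Int.sign_mul_self_eq_natAbs, mul_left_comm]
  have hM : N * D.natAbs ≠ 0 := mul_ne_zero hN (Int.natAbs_ne_zero.2 hD)
  have heα : End.asHom (ψ α) ≫ (D.sign • t₁) = (D.sign • t₁) ≫ End.asHom (φ α) := by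
    rw [Preadditive.comp_zsmul, Preadditive.zsmul_comp, he₁]
  exact ⟨D.sign • t₁, N * D.natAbs, hM, ht, comp_eq_comp_of_nsmul_generator ψ φ α heα hgen⟩

/-! ### Over a perfect field every equivariant surjection has an equivariant quasi-section -/

section PerfectField

variable [PerfectField K]

/-- **Equivariant quasi-sections over a perfect field, commutative ring generated up to isogeny by
one element**: an equivariant surjection `f : S ↠ B` has an equivariant `t̃ : B ⟶ S` with
`t̃ ≫ f = M • 𝟙 B`, `M ≠ 0` (a quasi-section exists, `exists_quasiSection_of_perfectField`, and is
averaged by `exists_equivariant_quasiSection_of_generator`).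
[cite: MumfordAV1970, §19 Thm. 1 and Remark p. 169] [cite: Pierce1982, §10.2] -/
theorem exists_equivariant_quasiSection_of_perfectField_of_generator {R : Type v} [CommRing R]
    (φ : R →+* End S) (ψ : R →+* End B) (f : S ⟶ B) [Surjective (Hom.toSchemeHom f)]
    (hf : ∀ r : R, End.asHom (φ r) ≫ f = f ≫ End.asHom (ψ r)) (α : R) (p cu cv : Polynomial ℤ)
    (D : ℤ) (hD : D ≠ 0) (hp : aeval α p = 0) (hcert : cu * p + cv * derivative p = C D)
    (hgen : ∀ r : R, ∃ (m : ℕ) (q : Polynomial ℤ), m ≠ 0 ∧ (m : R) * r = aeval α q) :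
    ∃ (t' : B ⟶ S) (M : ℕ), M ≠ 0 ∧ t' ≫ f = M • 𝟙 B ∧
      ∀ r : R, End.asHom (ψ r) ≫ t' = t' ≫ End.asHom (φ r) := by
  obtain ⟨t, N, hN, htf⟩ := exists_quasiSection_of_perfectField f
  exact exists_equivariant_quasiSection_of_generator φ ψ hf hN htf α p cu cv D hD hp hcert hgen

/-- **Equivariant quasi-sections over a perfect field, finite group**: an equivariant surjection
`f : S ↠ B` of abelian varieties with actions of a finite group has an equivariant
quasi-section. [cite: LangeRodriguez2022, Thm. 2.7.1] [cite: MumfordAV1970, §19 Thm. 1 and Remark p. 169] -/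
theorem exists_equivariant_quasiSection_of_perfectField_of_fintype {G : Type v} [Group G]
    [Fintype G] (ρ : G →* End S) (ρ' : G →* End B) (f : S ⟶ B)
    [Surjective (Hom.toSchemeHom f)] (hf : ∀ g : G, End.asHom (ρ g) ≫ f = f ≫ End.asHom (ρ' g)) :
    ∃ (t' : B ⟶ S) (M : ℕ), M ≠ 0 ∧ t' ≫ f = M • 𝟙 B ∧
      ∀ g : G, End.asHom (ρ' g) ≫ t' = t' ≫ End.asHom (ρ g) := by
  obtain ⟨t, N, hN, htf⟩ := exists_quasiSection_of_perfectField f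
  obtain ⟨t', ht', he⟩ := exists_equivariant_quasiSection_of_fintype ρ ρ' hf htf
  exact ⟨t', Fintype.card G * N, mul_ne_zero Fintype.card_ne_zero hN, ht', he⟩

/-- **Equivariant quasi-sections over a perfect field, complex multiplication by `𝓞_K`**: an
`𝓞_K`-equivariant surjection `f : S ↠ B` has an `𝓞_K`-equivariant quasi-section (all side
hypotheses of the generator form discharged by
`NumberField.RingOfIntegers.exists_generator_certificate`).
[cite: MumfordAV1970, §19 Thm. 1 and Remark p. 169] [cite: Pierce1982, §10.2] -/
theorem exists_equivariant_quasiSection_of_perfectField_of_ringOfIntegers {L : Type*} [Field L]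
    [NumberField L] (φ : 𝓞 L →+* End S) (ψ : 𝓞 L →+* End B) (f : S ⟶ B)
    [Surjective (Hom.toSchemeHom f)]
    (hf : ∀ r : 𝓞 L, End.asHom (φ r) ≫ f = f ≫ End.asHom (ψ r)) :
    ∃ (t' : B ⟶ S) (M : ℕ), M ≠ 0 ∧ t' ≫ f = M • 𝟙 B ∧
      ∀ r : 𝓞 L, End.asHom (ψ r) ≫ t' = t' ≫ End.asHom (φ r) := by
  obtain ⟨α, p, cu, cv, D, hD, hp, hcert, hgen⟩ :=
    NumberField.RingOfIntegers.exists_generator_certificate L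
  exact exists_equivariant_quasiSection_of_perfectField_of_generator φ ψ f hf α p cu cv D hD hp
    hcert hgen

end PerfectField

end AbelianVariety

end Literature.AlgebraicGeometry.Motives

end
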